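import Summits.KontsevichZagierPeriods.KontsevichZagierPeriods.Theorems.SoloInformedCornerCfg
import HarnessLib

/-!
# One sector piece of the corner step: transport from the child configuration

Solo programme `solo-KontsevichZagierPeriods-informed`, session s111, step (γ-9) of the kernel
project PRES-RAT(2) (the corner step of the vertex recursion).

Let `(F, D, Ω)` be a corner configuration, `P/D` the integrand (`P` of order `≥ s`, `D` of order
`≥ d = c + d₁` at the corner, `s + 1 = c + s₁`), and `S = S(κ, t, λ) = Φ((0,1)²)` a sector whose
slope interval `t + λ (0, 1]` carries no tangent direction of `F`.  Along `Φ = Φ_{κ,t,λ}`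

  `(P/D)(Φ x) · κ² |λ| x₀ = P'(x) / D'(x)`,  `P' = (κ^{s₁+1} |λ| / κ^{d₁}) x₀^{s₁} child_P`,
  `D' = x₀^{d₁} child_D`

(the `c` common powers of `x₀` cancelled), and `(child_F, D', Ω')` with
`Ω' = {x ∈ (0,1)² | Φ x ∈ Ω}` is again a corner configuration (file `SoloInformedCornerCfg`).
Hence, by Kontsevich–Zagier rule (2) along `Φ` (file `SoloInformedSectorMap`): if every corner
configuration of the child pair `(child_F, D')` is presentable (the induction hypothesis of the
vertex recursion), then `P/D` is presentable on `Ω ∩ S`.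

References: Kontsevich–Zagier, *Periods* (2001), §1.2 rule (2).
-/

noncomputable section

open scoped BigOperators
open MeasureTheory Set
open Literature.NumberTheory.Transcendental Literature.NumberTheory.Transcendental.KZ
open Literature.ModelTheory.ExponentialFields (IsSemialgebraic)

namespace Summit.KontsevichZagierPeriods.KontsevichZagierPeriods.Theorems

variable {K : Type*} [Field K] [Algebra K ℝ]

/-- **Corner presentability of a pair `(F, D)`**: on every corner configuration of `(F, D)`,
every `P/D` is presentable. [this work] -/
def SoloInformedCornerOK (F D : MvPolynomial (Fin 2) K) : Prop :=
  ∀ (Ω : Set (Fin 2 → ℝ)) (P : MvPolynomial (Fin 2) K), SoloInformedCornerCfg F D Ω →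
    SoloInformedPresOn Ω fun z => (MvPolynomial.aeval z P : ℝ) / MvPolynomial.aeval z D

/-- An element of `K` whose real image is `|λ|`. [this work] -/
def soloInformedAbsK (lam : K) : K := if 0 ≤ algebraMap K ℝ lam then lam else -lam

/-- `absK λ ↦ |λ|`. -/
theorem soloInformed_algebraMap_absK (lam : K) :
    algebraMap K ℝ (soloInformedAbsK lam) = |algebraMap K ℝ lam| := by
  unfold soloInformedAbsK
  split_ifs with h
  · rw [abs_of_nonneg h]
  · rw [map_neg, abs_of_neg (not_le.1 h)]

/-- The child numerator `P' = (κ^{s₁+1} |λ| / κ^{d₁}) · x₀^{s₁} · child_P(s)`. [this work] -/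
def soloInformedChildNumK (P : MvPolynomial (Fin 2) K) (s s₁ d₁ : ℕ) (t κ lam : K) :
    MvPolynomial (Fin 2) K :=
  MvPolynomial.C (κ ^ (s₁ + 1) * soloInformedAbsK lam / κ ^ d₁) * MvPolynomial.X 0 ^ s₁ *
    soloInformedChildK P s t κ lam

/-- The child denominator `D' = x₀^{d₁} · child_D(c + d₁)`. [this work] -/
def soloInformedChildDenK (D : MvPolynomial (Fin 2) K) (c d₁ : ℕ) (t κ lam : K) :
    MvPolynomial (Fin 2) K :=
  MvPolynomial.X 0 ^ d₁ * soloInformedChildK D (c + d₁) t κ lam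

/-- **The integrand identity along a sector map**: `(P/D)(Φ x) · κ² |λ| x₀ = P'(x)/D'(x)`
off the edge `x₀ = 0` (both sides vanish where `child_D` does, by the convention `a / 0 = 0`).
[this work] -/
theorem soloInformed_sector_integrand {P D : MvPolynomial (Fin 2) K} {s c s₁ d₁ : ℕ}
    (hss : s + 1 = c + s₁) (hsP : ∀ a ∈ P.support, s ≤ a 0 + a 1)
    (hd : ∀ a ∈ D.support, c + d₁ ≤ a 0 + a 1) (t : K) {κ lam : K} (hκ : algebraMap K ℝ κ ≠ 0)
    {x : Fin 2 → ℝ} (hx : x 0 ≠ 0) :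
    (MvPolynomial.aeval (soloInformedSectorMap (algebraMap K ℝ κ) (algebraMap K ℝ t)
        (algebraMap K ℝ lam) x) P : ℝ) /
      MvPolynomial.aeval (soloInformedSectorMap (algebraMap K ℝ κ) (algebraMap K ℝ t)
        (algebraMap K ℝ lam) x) D * (algebraMap K ℝ κ ^ 2 * |algebraMap K ℝ lam| * x 0) =
    (MvPolynomial.aeval x (soloInformedChildNumK P s s₁ d₁ t κ lam) : ℝ) /
      MvPolynomial.aeval x (soloInformedChildDenK D c d₁ t κ lam) := by
  rw [soloInformed_aeval_sectorMap P hsP, soloInformed_aeval_sectorMap D hd]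
  unfold soloInformedChildNumK soloInformedChildDenK
  simp only [map_mul, map_pow, MvPolynomial.aeval_C, MvPolynomial.aeval_X, map_div₀,
    soloInformed_algebraMap_absK]
  set κ' := algebraMap K ℝ κ
  set l := |algebraMap K ℝ lam|
  set Pv := (MvPolynomial.aeval x (soloInformedChildK P s t κ lam) : ℝ)
  set Dv := (MvPolynomial.aeval x (soloInformedChildK D (c + d₁) t κ lam) : ℝ)
  by_cases hD : Dv = 0
  · simp [hD]
  have hκx : κ' * x 0 ≠ 0 := mul_ne_zero hκ hx
  rw [div_mul_eq_mul_div, div_eq_div_iff (mul_ne_zero (pow_ne_zero _ hκx) hD)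
    (mul_ne_zero (pow_ne_zero _ hx) hD)]
  have e1 : (κ' * x 0) ^ s * Pv * (κ' ^ 2 * l * x 0) = κ' ^ (s + 1) * κ' * l * Pv * x 0 ^ (s + 1)
      := by ring
  rw [e1, hss]
  field_simp
  ring

/-- **One sector piece.**  For a corner configuration `(F, D, Ω)`, a numerator `P` and a sector
`S(κ, t, λ)` (`0 < κ ≤ 1`, `λ ≠ 0`, slopes `t, t + λ ≥ 0` with `κ t, κ (t + λ) ≤ 1`, no tangent
direction of `F` in `t + λ (0, 1]`): if the child pair `(child_F, D')` is corner-presentable,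
then `P/D` is presentable on `Ω ∩ S(κ, t, λ)`. [this work] -/
theorem soloInformed_presOn_inter_sector_of_child
    (hK : ∀ c : K, IsAlgebraic ℚ (algebraMap K ℝ c)) {F D : MvPolynomial (Fin 2) K}
    {Ω : Set (Fin 2 → ℝ)} (h : SoloInformedCornerCfg F D Ω) {m s c s₁ d₁ : ℕ}
    (hm : ∀ a ∈ F.support, m ≤ a 0 + a 1) (hcone : soloInformedConePolyK F m ≠ 0)
    (hd : ∀ a ∈ D.support, c + d₁ ≤ a 0 + a 1) {P : MvPolynomial (Fin 2) K}
    (hsP : ∀ a ∈ P.support, s ≤ a 0 + a 1) (hss : s + 1 = c + s₁) {t κ lam : K}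
    (hκ0 : 0 < algebraMap K ℝ κ) (hκ1 : algebraMap K ℝ κ ≤ 1) (hlam : algebraMap K ℝ lam ≠ 0)
    (ht0 : 0 ≤ algebraMap K ℝ t) (hs0 : 0 ≤ algebraMap K ℝ t + algebraMap K ℝ lam)
    (hkt : algebraMap K ℝ κ * algebraMap K ℝ t ≤ 1)
    (hks : algebraMap K ℝ κ * (algebraMap K ℝ t + algebraMap K ℝ lam) ≤ 1)
    (hroot : ∀ y : ℝ, 0 < y → y ≤ 1 →
      Polynomial.aeval (algebraMap K ℝ t + algebraMap K ℝ lam * y) (soloInformedConePolyK F m) ≠ 0)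
    (hchild : SoloInformedCornerOK (soloInformedChildK F m t κ lam)
      (soloInformedChildDenK D c d₁ t κ lam)) :
    SoloInformedPresOn (Ω ∩ soloInformedSector (algebraMap K ℝ κ) (algebraMap K ℝ t)
      (algebraMap K ℝ lam)) fun z => (MvPolynomial.aeval z P : ℝ) / MvPolynomial.aeval z D := by
  have hcfg := soloInformed_cornerCfg_child_of_slope hK h hm hcone hd hκ0 hκ1 hlam ht0 hs0 hkt hks
    hroot d₁
  have h1 := hchild _ (soloInformedChildNumK P s s₁ d₁ t κ lam) hcfg
  refine soloInformed_presOn_inter_sector hK hκ0 hlam h.isSemialgebraic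
    ((soloInformed_presOn_congr fun x hx => ?_).2 h1)
  exact soloInformed_sector_integrand hss hsP hd t hκ0.ne' (hx.1 0).1.ne'

end Summit.KontsevichZagierPeriods.KontsevichZagierPeriods.Theorems
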